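import Summits.HodgeConjecture.HodgeConjecture.Theorems.K2E5QuatZetaResidueOfParts   -- ★ (R0) p856054: `quatZetaResidue_of_parts`
import Summits.HodgeConjecture.HodgeConjecture.Theorems.K2E5QuatZetaSplit            -- ★ (R1) p856065: `aestronglyMeasurable_inner`, `quatZeta_eq_integral_exp_mul_inner`
import Summits.HodgeConjecture.HodgeConjecture.Theorems.K2E5QuatZetaPlusBound        -- ★ (R2) p856082: `norm_inner_le_exp_two`
import HarnessLib

/-!
# K2 ∕ E5 «TamagawaUnitary» — tier-2 file `K2E5QuatZetaResidueOfMinus`: socket G3 `sig_K2E5QuatZetaResidue` CLOSED MODULO THE SINGLE PART (R4) `hminus`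

Track B «K2-LIT», engine E5, crux H413 (`stmt-HodgeConjecture-24833`); seat K2E5-p07 (g0), G3 RESIDUE LEAD (K2E5-plan (g2) SWEEP #12b (26)).  Layer (R5⁻): the socket's statement with
ALL its binders (token for token, in theorem form) and ONE extra hypothesis — the Poisson principal part `hminus` of ★ (R0) (being paid by K2E5-p14 (g0) as (R4)
`K2E5QuatZetaMinusPrincipalPart`, over their ★ (R3) `K2E5QuatThetaPoisson` p856069 by REFOLDING the dual theta series into the inner integral of `Φ̂` at `−t` and ★ (R2)).  Proof:
★ (R0) `quatZetaResidue_of_parts` fed with ★ (R1) (`hIm`, `hZ`: disintegration + `|det(yθ_t)| = e^t` + Fubini under ★ (g)) and ★ (R2) (`hplus`: unfolding inequality + ★ p01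
`thetaTail_le_exp` + Fujisaki ★ G1′).  The by-name file `Theorems/K2E5QuatZetaResidue.lean` (R5) is then `quatZetaResidue_of_minus … (R4-head …)`.
No `sorry`, no `instance`, no `notation`, axioms ⊆ the trio.

HONEST LABEL: HC_CM is proved only modulo the 7 printed citations (2 remaining named inputs: hLiu418 = stmt-HodgeConjecture-24832, h413 = stmt-HodgeConjecture-24833) until rung 0
closes; this file is a helper (`--supports stmt-HodgeConjecture-24833 --as helper`) and changes no count.

## References
[VignerasLNM800] M.-F. Vignéras, LNM 800 (1980), Ch. III §2 Thm. 2.2 · [WeilBNT1967] A. Weil, *Basic Number Theory* (1967), Ch. VII §5 Prop. 11, §6 Thm. 4; Ch. IV §3 Thm. 4 ·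
[TateThesis1967] J. Tate, in Cassels–Fröhlich (1967), Ch. XV §4.4 Main Thm. 4.4.1.
-/

set_option autoImplicit false
set_option linter.dupNamespace false

noncomputable section

namespace Summit.HodgeConjecture.HodgeConjecture.Cruxes.H413.K2E5QuatZetaResidueOfMinus

open NumberField IsDedekindDomain MeasureTheory MeasureTheory.Measure Filter Topology Set
open scoped Matrix MatrixGroups NNReal ENNReal
open Literature.MeasureTheory.Group Literature.NumberTheory Literature.NumberTheory.Automorphic
open Literature.AlgebraicGeometry.ShimuraVarieties (hermForm)
open Summit.HodgeConjecture.HodgeConjecture.Cruxes.H413.K2E5QuatAdelicMatrixModel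
open Summit.HodgeConjecture.HodgeConjecture.Cruxes.H413.K2E5QuatZeta
open Summit.HodgeConjecture.HodgeConjecture.Cruxes.H413.K2E5QuatAdelicLattice
open Summit.HodgeConjecture.HodgeConjecture.Cruxes.H413.K2E5QuatAdelicModuleOne

section Main

set_option synthInstance.maxHeartbeats 400000
set_option maxHeartbeats 1600000

/-- **SOCKET G3 MODULO (R4)**: for `h` hermitian anisotropic non-degenerate, any additive Haar `ν` on `𝔸⁺`, any `dx` on `(D_h ⊗ 𝔸)^×` disintegrated as `dx = dx¹ ⊗ dt` along the
central ray (`hdis`), and `Φ ∈ 𝒮`: IF the contracting half has the Poisson principal part `‖e^t(I(t) + V Φ(0)) − V·(∫Φ∘quatCoord dν⁴)∕ν⁴(F)‖ ≤ B e^{κt}` (`t ≤ 0`, `κ > 0`;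
part (R4)), THEN `(s − 1)·Z(Φ, s; dx) → V · (∫ Φ∘quatCoord dν⁴) ∕ ν⁴(F)` as `s → 1⁺` — the conclusion of `sig_K2E5QuatZetaResidue` token for token.
[cite: VignerasLNM800, Ch. III §2 Thm. 2.2] [cite: WeilBNT1967, Ch. VII §5 Prop. 11] [cite: TateThesis1967, §4.4] -/
theorem quatZetaResidue_of_minus
    (L : Type) [Field L] [NumberField L] [IsCMField L] (Ha : Matrix (Fin 2) (Fin 2) L)
    (hHa : (Ha.map (cmConjRingHom L)).transpose = Ha) (hanis : ∀ x : Fin 2 → L, hermForm (cmConjRingHom L) Ha x x = 0 → x = 0) (hdet : Ha.det ≠ 0)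
    [MeasurableSpace (GL (Fin 2) (AdeleRing (𝓞 L) L))] [BorelSpace (GL (Fin 2) (AdeleRing (𝓞 L) L))]
    [MeasurableSpace (AdeleRing (𝓞 ↥(maximalRealSubfield L)) ↥(maximalRealSubfield L))]
    [MeasurableSpace (↥(quatAdelicUnitsOne L Ha) ⧸ quatRatLatticeOne L Ha)] [BorelSpace (↥(quatAdelicUnitsOne L Ha) ⧸ quatRatLatticeOne L Ha)]
    (ν : Measure (AdeleRing (𝓞 ↥(maximalRealSubfield L)) ↥(maximalRealSubfield L)))
    (dx : Measure ↥(quatAdelicUnits L Ha))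
    [LocallyCompactSpace ↥(quatAdelicUnitsOne L Ha)] [SecondCountableTopology ↥(quatAdelicUnitsOne L Ha)] [T2Space ↥(quatAdelicUnitsOne L Ha)]
    (dx1 : Measure ↥(quatAdelicUnitsOne L Ha)) [dx1.IsHaarMeasure] [dx1.IsMulRightInvariant]
    [(count : Measure ↥(quatRatLatticeOne L Ha)).IsHaarMeasure]
    (hdis : ∀ f : ↥(quatAdelicUnits L Ha) → ℝ≥0∞, Measurable f →
      ∫⁻ x, f x ∂dx = ∫⁻ t : ℝ, ∫⁻ y, f ((y : ↥(quatAdelicUnits L Ha)) *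
        quatModuleSection L Ha (Units.mk0 (Real.toNNReal (Real.exp t)) (Real.toNNReal_pos.2 (Real.exp_pos t)).ne')) ∂dx1)
    {Φ : Matrix (Fin 2) (Fin 2) (AdeleRing (𝓞 L) L) → ℂ}
    (hΦ : Φ ∈ quatSchwartzBruhat L (fun i => ((quatBasis L Ha hHa hdet i : ↥(quatRatSubalgebra L Ha)) : Matrix (Fin 2) (Fin 2) L)))
    -- (R4) the Poisson principal part of the contracting half (★ (R0)'s `hminus`, token for token)
    (hminus : ∃ B κ : ℝ, 0 < κ ∧ ∀ t : ℝ, t ≤ 0 → ‖(Real.exp t : ℂ) *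
        ((∫ y : ↥(quatAdelicUnitsOne L Ha), Φ ((((y : ↥(quatAdelicUnits L Ha)) *
            quatModuleSection L Ha (Units.mk0 (Real.toNNReal (Real.exp t)) (Real.toNNReal_pos.2 (Real.exp_pos t)).ne') : ↥(quatAdelicUnits L Ha)) :
              GL (Fin 2) (AdeleRing (𝓞 L) L)) : Matrix (Fin 2) (Fin 2) (AdeleRing (𝓞 L) L)) ∂dx1) +
          (((quotientMeasure (quatRatLatticeOne L Ha) (count : Measure ↥(quatRatLatticeOne L Ha)) (isClosed_quatRatLatticeOne L Ha) dx1)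
              Set.univ).toReal : ℂ) * Φ 0) -
        (((quotientMeasure (quatRatLatticeOne L Ha) (count : Measure ↥(quatRatLatticeOne L Ha)) (isClosed_quatRatLatticeOne L Ha) dx1)
              Set.univ).toReal : ℂ) *
            (∫ a, Φ (quatCoord L (fun i => ((quatBasis L Ha hHa hdet i : ↥(quatRatSubalgebra L Ha)) : Matrix (Fin 2) (Fin 2) L)) a)
                ∂(Measure.pi fun _ : Fin 4 => ν)) /
            (((Measure.pi fun _ : Fin 4 => ν) (piFundamentalDomain (↥(maximalRealSubfield L)) (Fin 4))).toReal : ℂ)‖ ≤ B * Real.exp (κ * t)) :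
    Tendsto (fun s : ℝ => ((s : ℂ) - 1) * quatZeta L Ha dx Φ (s : ℂ)) (𝓝[>] (1 : ℝ))
      (𝓝 ((((quotientMeasure (quatRatLatticeOne L Ha) (count : Measure ↥(quatRatLatticeOne L Ha)) (isClosed_quatRatLatticeOne L Ha) dx1)
              Set.univ).toReal : ℂ) *
            (∫ a, Φ (quatCoord L (fun i => ((quatBasis L Ha hHa hdet i : ↥(quatRatSubalgebra L Ha)) : Matrix (Fin 2) (Fin 2) L)) a)
                ∂(Measure.pi fun _ : Fin 4 => ν)) /
            (((Measure.pi fun _ : Fin 4 => ν) (piFundamentalDomain (↥(maximalRealSubfield L)) (Fin 4))).toReal : ℂ))) :=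
  K2E5QuatZetaResidueOfParts.quatZetaResidue_of_parts L Ha hHa hdet ν dx dx1 Φ
    (K2E5QuatZetaSplit.aestronglyMeasurable_inner L hHa hdet dx1 hΦ)
    (fun _ hs => K2E5QuatZetaSplit.quatZeta_eq_integral_exp_mul_inner L hHa hdet hanis dx dx1 hdis hΦ hs)
    (K2E5QuatZetaPlusBound.norm_inner_le_exp_two L hHa hdet hanis dx1 hΦ) hminus

end Main

end Summit.HodgeConjecture.HodgeConjecture.Cruxes.H413.K2E5QuatZetaResidueOfMinus

end
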